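import Summits.BirchSwinnertonDyer.BirchSwinnertonDyer.Theorems.EisensteinPrimesResidualDevissageFiniteKernel
import Summits.BirchSwinnertonDyer.BirchSwinnertonDyer.Theorems.EisensteinPrimesCharLocalInertiaBounds
import Literature.NumberTheory.EllipticCurves.KellerYin2024.CharacterSelmerGroups
import Literature.NumberTheory.EllipticCurves.KellerYin2024.CharacterModulePrufer
import Literature.NumberTheory.EllipticCurves.IwasawaAlgebraProofs
import HarnessLib

/-!
# `R_v̄^{S₀}(K_∞, 𝔽(θ̄))` is FINITE once `𝔛_θ^{S₀} = H¹_{𝓕_nr^{S₀}}(K_∞, (F/𝒪)(θ))^∨` is f.g. `Λ`-torsion with `μ = 0`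
# (cell `bsd-eis`, seat `bsd-line-x1-p1` LEAD g3, D-0154 KEY row 4; crux 2 `GoodLatticeBDPValue`
# stmt-BirchSwinnertonDyer-19032, line `halves` v17, stub `stub_imprim` = Keller–Yin Thm. 1.4.1)

HONEST FRAMING (cell `bsd-eis`, run/shared/lean/pub/bsd-eis/): Galois-cohomology bookkeeping on constructed
objects; no definition, no named fact, no `sorry`, no `Theses` import; nothing about any curve is asserted;
BSD / IMC2 / KY Thm. 1.4.1 are proved for NO curve. Helper `--supports stmt-BirchSwinnertonDyer-19032`.

## Why
KY Thm. 1.4.1 (`thm141_imprimlambda_goodLattice_OPEN`, PRE) = (i) `𝔛_f^{Sf}` f.g. `Λ`-torsion, `μ = 0`;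
(ii) the same for `𝔛_f`; (iii) the `λ`-identity. (i)–(ii) are the residual dévissage along
`0 → 𝔽(ω̃) → E_K[p] → 𝔽(𝟙̃) → 0`, whose `E`-side WITHOUT the non-anomalous clause is the tree's
`ResidualDevissageFiniteKernel.finite_selmerAc_pTorsion_of_line_devissage_of_finite` (p628626); so far it was
fed by the character-level PREPRINT clause `prop125_residualCharacterUnrSelmer_finite_OPEN` (p629299). This
file derives the character input instead from the MODULE statement the `halves` line proves in the kernel
modulo PUBLISHED facts (first clause of `prop125_residualPair_unrSelmer_imprimitive`, p631421 ∘ p611963 ∘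
p569470): §1 PONTRYAGIN — a dual datum f.g. over `ℤ_p` (⟸ torsion + `μ = 0`, `muInvariant_eq_zero_iff_holds`)
forces `S^{S₀}_M(K_∞)[p]` finite (verbatim `UniversalToricDescentAcDualMuZero.finite_pTorsion_of_moduleFinite_padicInt`
for Greenberg–Vatsal dual data); §2–§3 KUMMER — for `B = (F/𝒪)(θ)`, `θ^{p−1} = 1`, ANY `H ≤ Γ_K` and an
equivariant `j : A ↪ B` onto `B[p]`, `j_* : H¹(H, A) → H¹(H, B)` is INJECTIVE (`θ|_H = 1`: no coboundaries;
else some `θ(h) − 1 ∈ ℤ_p^×` by Teichmüller, so `B^H = 0` and a `p`-torsion coboundary `∂b` has `b ∈ B[p]`;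
KY Lemma 1.2.4 / CGLS Lemma 13); §4 — `R_v̄^{S₀}(K_∞, A) ↪ H¹_{𝓕_nr^{S₀}}(K_∞, B)[p]`
(`resH1Hom_id_mem_residualSelmer`, `grSelmer_le_unrSelmer`, `pA = 0`), hence finite. The `E`-level clauses
and the `IsResidualPairOver` plumbing are the next files.

References: [KellerYin2024] Lemma 1.2.4, Prop. 1.2.5, Thm. 1.4.1 (arXiv:2402.12781v2 TeX L641–800,
L1087–1098); [CastellaGrossiLeeSkinner2022] Lemma 13, Props. 14, 17–18 (arXiv:2008.02571); [GreenbergLNM1716]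
§1 p. 60; [LimSujatha2018] §3; [Washington1997] §13.2; [SerreGaloisCohomology1997] I.§2.2–2.3.
-/

set_option autoImplicit false
set_option linter.dupNamespace false -- the summit namespace `…BirchSwinnertonDyer.BirchSwinnertonDyer.Theorems` (Sub = Summit, D-0017) trips it

noncomputable section

open scoped Classical

universe u

namespace Summit.BirchSwinnertonDyer.BirchSwinnertonDyer.Theorems.CharResidualSelmerFinite

open NumberField IsDedekindDomain Field
open Literature.NumberTheory.EllipticCurves Literature.NumberTheory.EllipticCurves.GreenbergSelmer
  Literature.NumberTheory.EllipticCurves.GreenbergVatsal2000 Literature.NumberTheory.GaloisRepresentations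
  Literature.NumberTheory.EllipticCurves.KellerYin2024 Literature.NumberTheory.IwasawaTheory
  Summit.BirchSwinnertonDyer.Rank1Residual.X11b Summit.BirchSwinnertonDyer.Rank1Residual.X11b.AcSelmer
  Summit.BirchSwinnertonDyer.BirchSwinnertonDyer.Theorems.UniversalToricDescentResidualSelmer
  Summit.BirchSwinnertonDyer.BirchSwinnertonDyer.Theorems.CumulativeHeegnerInclusionAtThreeStubB1DevissageNamed
  Summit.BirchSwinnertonDyer.BirchSwinnertonDyer.Theorems.CharLocalInertiaBounds

/-! ### §1 Pontryagin: a dual datum finitely generated over `ℤ_p` forces `S^{S₀}_M(K_∞)[p]` finite -/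

section Pontryagin

variable {K : Type} [Field K] [NumberField K] {p : ℕ} [hp : Fact p.Prime] {κ : ZpExtension K p}
  {γ : absoluteGaloisGroup K} {M : Type} [AddCommGroup M] [DistribMulAction (absoluteGaloisGroup K) M]
  [TopologicalSpace M] [DiscreteTopology M] {L : Data K M p} {S₀ : Set (HeightOneSpectrum (𝓞 K))}

/-- **A dual datum of `S^{S₀}_M(K_∞)` finitely generated over `ℤ_p` ⟹ `S^{S₀}_M(K_∞)[p]` finite**: with
`ℤ_p`-generators `x₁, …, xₙ` of `D.X ≅ Hom(S^{S₀}_M(K_∞), ℚ/ℤ)`, `s ↦ (xᵢ(s))ᵢ` embeds `Sel[p]` into the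
finite `(ℚ/ℤ[p])ⁿ` — a character agreeing at `s`, `s'` on every generator agrees there identically
(constants act through `ℤ_p → ℤ/p` on values at `p`-torsion classes, `toDual_C_smul`), and characters
separate points. Verbatim the tree's `UniversalToricDescentAcDualMuZero.finite_pTorsion_of_moduleFinite_padicInt`.
[cite: LimSujatha2018, §3 (before Prop. 3.2)] [cite: GreenbergLNM1716, §1 p. 60] -/
theorem finite_pTorsion_of_moduleFinite_padicInt (D : DatumDualData κ γ M L S₀)
    (hD : Module.Finite ℤ_[p] (RestrictScalars ℤ_[p] (IwasawaAlgebra p) D.X)) :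
    Set.Finite {s : datumSelmerInfty κ M L S₀ | p • s = 0} := by
  obtain ⟨G, hG⟩ := hD
  have hT : {u : AddCircle (1 : ℚ) | p • u = 0}.Finite := AddCircle.finite_torsion (1 : ℚ) hp.out.pos
  haveI : Finite {u : AddCircle (1 : ℚ) | p • u = 0} := hT.to_subtype
  -- the identification `RestrictScalars ℤ_p Λ X = X` (a type synonym), read through `toDual`
  let toX : RestrictScalars ℤ_[p] (IwasawaAlgebra p) D.X → (datumSelmerInfty κ M L S₀ →+ AddCircle (1 : ℚ)) :=
    fun x ↦ D.toDual x
  have hadd : ∀ (x y : RestrictScalars ℤ_[p] (IwasawaAlgebra p) D.X) (t : datumSelmerInfty κ M L S₀),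
      toX (x + y) t = toX x t + toX y t := fun x y t ↦
    congrArg (fun f : datumSelmerInfty κ M L S₀ →+ AddCircle (1 : ℚ) ↦ f t)
      (D.toDual.map_add (show D.X from x) (show D.X from y))
  have hzero : ∀ t : datumSelmerInfty κ M L S₀,
      toX (0 : RestrictScalars ℤ_[p] (IwasawaAlgebra p) D.X) t = 0 := fun t ↦
    congrArg (fun f : datumSelmerInfty κ M L S₀ →+ AddCircle (1 : ℚ) ↦ f t) D.toDual.map_zero
  have hsmul : ∀ (c : ℤ_[p]) (x : RestrictScalars ℤ_[p] (IwasawaAlgebra p) D.X),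
      toX (c • x) = D.toDual ((PowerSeries.C c : IwasawaAlgebra p) • (show D.X from x)) :=
    fun _ _ ↦ rfl
  -- evaluation at the generators
  let ev : {s : datumSelmerInfty κ M L S₀ | p • s = 0} →
      ({x : RestrictScalars ℤ_[p] (IwasawaAlgebra p) D.X // x ∈ G} →
        {u : AddCircle (1 : ℚ) | p • u = 0}) :=
    fun s x ↦ ⟨toX x.1 s.1, by
      change p • toX x.1 s.1 = 0
      rw [← map_nsmul, s.2, map_zero]⟩
  refine Set.finite_coe_iff.mp (Finite.of_injective ev fun s s' hss' ↦ ?_)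
  -- a character agreeing at `s`, `s'` on all generators agrees there identically
  have hgen : ∀ x : RestrictScalars ℤ_[p] (IwasawaAlgebra p) D.X,
      toX x (s.1 : datumSelmerInfty κ M L S₀) = toX x (s'.1 : datumSelmerInfty κ M L S₀) := by
    intro x
    have hx : x ∈ Submodule.span ℤ_[p]
        (G : Set (RestrictScalars ℤ_[p] (IwasawaAlgebra p) D.X)) := by
      rw [hG]; exact Submodule.mem_top
    refine Submodule.span_induction (M := RestrictScalars ℤ_[p] (IwasawaAlgebra p) D.X)
      (p := fun y _ ↦ toX y (s.1 : datumSelmerInfty κ M L S₀) = toX y (s'.1 : datumSelmerInfty κ M L S₀))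
      ?_ ?_ ?_ ?_ hx
    · intro y hy
      have := congrArg (fun f ↦ ((f ⟨y, Finset.mem_coe.mp hy⟩ : {u : AddCircle (1 : ℚ) | p • u = 0}) :
        AddCircle (1 : ℚ))) hss'
      exact this
    · rw [hzero, hzero]
    · intro y z _ _ hy hz
      rw [hadd, hadd, hy, hz]
    · intro c y _ hy
      have h1 : p ^ 1 • (s.1 : datumSelmerInfty κ M L S₀) = 0 := by rw [pow_one]; exact s.2
      have h2 : p ^ 1 • (s'.1 : datumSelmerInfty κ M L S₀) = 0 := by rw [pow_one]; exact s'.2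
      rw [hsmul, D.toDual_C_smul c _ _ 1 h1, D.toDual_C_smul c _ _ 1 h2]
      change (PadicInt.toZModPow 1 c).val • toX y s.1 = (PadicInt.toZModPow 1 c).val • toX y s'.1
      rw [hy]
  -- characters separate points of `Sel`
  apply Subtype.ext
  by_contra hne
  have hne' : (s.1 : datumSelmerInfty κ M L S₀) - s'.1 ≠ 0 := sub_ne_zero.mpr hne
  obtain ⟨χ, hχ⟩ := CharacterModule.exists_character_apply_ne_zero_of_ne_zero hne'
  obtain ⟨x, hx⟩ := D.bijective.2 χ
  apply hχ
  rw [map_sub, sub_eq_zero, ← hx]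
  exact hgen x

/-- **For a finitely generated torsion dual datum with `μ = 0`, `S^{S₀}_M(K_∞)[p]` is finite**
(Washington §13.2: `μ = 0` iff finitely generated over `ℤ_p`, tree `muInvariant_eq_zero_iff_holds`;
then the Pontryagin bookkeeping above). [cite: Washington1997, §13.2] [cite: LimSujatha2018, §3] -/
theorem finite_pTorsion_of_muInvariant_eq_zero (D : DatumDualData κ γ M L S₀)
    [Module.Finite (IwasawaAlgebra p) D.X] (hT : Module.IsTorsion (IwasawaAlgebra p) D.X)
    (hμ : muInvariant p D.X = 0) : Set.Finite {s : datumSelmerInfty κ M L S₀ | p • s = 0} :=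
  finite_pTorsion_of_moduleFinite_padicInt D ((muInvariant_eq_zero_iff_holds p D.X hT).mp hμ)

end Pontryagin

/-! ### §2 A criterion for the injectivity of `j_* : H¹(G, A) → H¹(G, B)` -/

section Kernel

variable {G : Type u} [Group G] [TopologicalSpace G] [IsTopologicalGroup G]
variable {A : Type u} [AddCommGroup A] [DistribMulAction G A] [TopologicalSpace A] [DiscreteTopology A]
variable {B : Type u} [AddCommGroup B] [DistribMulAction G B] [TopologicalSpace B] [DiscreteTopology B]

/-- **`j_* : H¹(G, A) → H¹(G, B)` is injective when every coboundary of `B` with values in `j(A)` is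
the image of a coboundary of `A`** (`j` injective): if `j ∘ φ = ∂b` then `∂b = j ∘ ∂a` for some `a`,
so `φ = ∂a`. (This is `ker j_* = im(δ : B^G… )`-free bookkeeping: the hypothesis says the connecting map
vanishes on the classes that matter.) [cite: SerreGaloisCohomology1997, I.§2.2 (Prop. 2)] -/
theorem resH1Hom_id_injective_of_coboundary_lift (j : A →+ B)
    (hj : ∀ (g : G) (a : A), j (ContinuousMonoidHom.id G g • a) = g • j a) (hinj : Function.Injective j)
    (hP : ∀ b : B, (∀ g : G, g • b - b ∈ j.range) → ∃ a : A, ∀ g : G, g • b - b = j (g • a - a)) :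
    Function.Injective (resH1Hom (ContinuousMonoidHom.id G) j hj) := by
  rw [injective_iff_map_eq_zero]
  intro y hy
  obtain ⟨φ, rfl⟩ := oneCocycleClass_surjective _ y
  rw [resH1Hom_id_oneCocycleClass, oneCocycleClass_eq_zero_iff] at hy
  obtain ⟨b, hb⟩ := hy
  have hb' : ∀ g : G, j (φ.1 g) = g • b - b := fun g ↦ hb g
  obtain ⟨a, ha⟩ := hP b fun g ↦ ⟨φ.1 g, hb' g⟩
  refine (oneCocycleClass_eq_zero_iff _ φ).mpr ⟨a, fun g ↦ ?_⟩
  change φ.1 g = g • a - a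
  apply hinj
  rw [hb', ha]

/-- **Classes of `H¹(G, A)` are `n`-torsion when `nA = 0`.** [cite: SerreGaloisCohomology1997, I.§2.2] -/
theorem nsmul_discreteH1_eq_zero {n : ℕ} (hn : ∀ a : A, n • a = 0) (c : discreteH1 G A) : n • c = 0 := by
  obtain ⟨φ, rfl⟩ := oneCocycleClass_surjective _ c
  have hs := oneCocycleClass_smul (discreteTopRep G A) ((n : ℕ) : ℤ) φ
  simp only [Nat.cast_smul_eq_nsmul] at hs
  rw [← hs]
  have h0 : n • φ = 0 := by
    apply Subtype.ext
    ext g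
    change n • φ.1 g = 0
    exact hn _
  rw [h0, oneCocycleClass_zero]

end Kernel

/-! ### §3 Kummer for a character: `H¹(H, 𝔽(θ̄)) → H¹(H, (F/𝒪)(θ))` is injective for every `H ≤ Γ_K` -/

section Character

variable {K : Type} [Field K] {p : ℕ} [hp : Fact p.Prime]
  (θ : FramedGaloisRep K (padicCoeffIntegers (∅ : Set (PadicAlgCl p))) 1)

/-- **Teichmüller: a `(p−1)`-th root of unity `u ≠ 1` of `ℤ_p` has `u − 1 ∈ ℤ_p^×`** (the reduction
`μ_{p−1}(ℤ_p) → 𝔽_p^×` is injective; tree `padicInt_eq_one_of_pow_eq_one_of_sub_one_mem`).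
[cite: SerreLocalFields1979, II §4 Prop. 8] -/
theorem isUnit_sub_one_of_pow_sub_one_eq_one_of_ne_one {u : ℤ_[p]} (hu : u ^ (p - 1) = 1) (h1 : u ≠ 1) :
    IsUnit (u - 1) := by
  by_contra hnu
  have hmem : u - 1 ∈ IsLocalRing.maximalIdeal ℤ_[p] := hnu
  have hnd : ¬ p ∣ p - 1 := fun h ↦ by
    have h1p := hp.out.one_lt
    have := Nat.le_of_dvd (Nat.sub_pos_of_lt h1p) h
    omega
  exact h1 (padicInt_eq_one_of_pow_eq_one_of_sub_one_mem hnd hu hmem)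

/-- **`Γ_K` acts on `(F/𝒪)(θ)` through `unitChar θ`, read back through `charModuleEquiv`**:
`σ • e⁻¹ z = e⁻¹ (θ(σ) z)`. [cite: KellerYin2024, §1.1 (arXiv:2402.12781v2 TeX L441–449)] -/
theorem galois_smul_charModuleEquiv_symm (σ : absoluteGaloisGroup K) (z : QpModZp p) :
    σ • (charModuleEquiv θ).symm z =
      (charModuleEquiv θ).symm (((unitChar θ σ : ℤ_[p]ˣ) : ℤ_[p]) • z) := by
  apply (charModuleEquiv θ).injective
  rw [charModuleEquiv_galois_smul, AddEquiv.apply_symm_apply, AddEquiv.apply_symm_apply]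

variable {A : Type} [AddCommGroup A] [DistribMulAction (absoluteGaloisGroup K) A] [TopologicalSpace A]
  [DiscreteTopology A]

omit [TopologicalSpace A] [DiscreteTopology A] in
/-- **The coboundary-lift property for the character module.** `θ^{p−1} = 1`, `H ≤ Γ_K` any subgroup,
`j : A → (F/𝒪)(θ)` equivariant with image EXACTLY the `p`-torsion: every `b` whose `H`-coboundary takes
values in `j(A)` has `∂b = j ∘ ∂a` for some `a ∈ A`. If `θ|_H = 1`, `∂b = 0 = j ∘ ∂0`. Otherwise pick
`h ∈ H` with `θ(h) ≠ 1`, so `θ(h) − 1 ∈ ℤ_p^×`; `p·∂b = 0` says `pb ∈ B^H ⊆ ker(θ(h) − 1) = 0`, hence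
`b = j a`. (KY Lemma 1.2.4 / CGLS Lemma 13: `H⁰(K_∞, M_θ)` is `0` or divisible.)
[cite: KellerYin2024, Lemma 1.2.4 (arXiv:2402.12781v2 TeX L760–778)] [cite: CastellaGrossiLeeSkinner2022, Lemma 13 (arXiv:2008.02571 §1.2)] -/
theorem coboundary_lift_charModule (hθ : ∀ σ : absoluteGaloisGroup K, θ σ ^ (p - 1) = 1)
    (H : Subgroup (absoluteGaloisGroup K))
    (j : A →+ charModule (∅ : Set (PadicAlgCl p)) θ)
    (hj : ∀ (σ : absoluteGaloisGroup K) (a : A), j (σ • a) = σ • j a)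
    (hrange : ∀ x : charModule (∅ : Set (PadicAlgCl p)) θ, x ∈ j.range ↔ p • x = 0)
    (b : charModule (∅ : Set (PadicAlgCl p)) θ) (hb : ∀ g : H, g • b - b ∈ j.range) :
    ∃ a : A, ∀ g : H, g • b - b = j (g • a - a) := by
  by_cases htriv : ∀ h : H, unitChar θ (h : absoluteGaloisGroup K) = 1
  · refine ⟨0, fun g ↦ ?_⟩
    have hfix : (g : absoluteGaloisGroup K) • b = b := by
      obtain ⟨z, rfl⟩ := (charModuleEquiv θ).symm.surjective b
      rw [galois_smul_charModuleEquiv_symm, htriv g, Units.val_one, one_smul]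
    rw [smul_zero, sub_zero, map_zero]
    exact sub_eq_zero.mpr hfix
  · obtain ⟨h₀, hh₀⟩ := not_forall.mp htriv
    -- `u := θ(h₀)`, `u^{p-1} = 1`, `u ≠ 1`, so `u - 1` is a unit
    have hupow : ((unitChar θ (h₀ : absoluteGaloisGroup K) : ℤ_[p]ˣ) : ℤ_[p]) ^ (p - 1) = 1 := by
      rw [← Units.val_pow_eq_pow_val, unitChar_pow_eq_one θ hθ, Units.val_one]
    have hu1 : ((unitChar θ (h₀ : absoluteGaloisGroup K) : ℤ_[p]ˣ) : ℤ_[p]) ≠ 1 := fun h ↦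
      hh₀ (Units.ext h)
    have hunit := isUnit_sub_one_of_pow_sub_one_eq_one_of_ne_one hupow hu1
    -- `p • b` is fixed by `H`
    have hpA : ∀ x : charModule (∅ : Set (PadicAlgCl p)) θ, x ∈ j.range → p • x = 0 :=
      fun x hx ↦ (hrange x).mp hx
    have hpb : ∀ g : H, (g : absoluteGaloisGroup K) • (p • b) = p • b := by
      intro g
      have h0 : p • ((g : absoluteGaloisGroup K) • b - b) = 0 := hpA _ (hb g)
      rw [smul_sub, sub_eq_zero, smul_comm] at h0
      exact h0
    -- hence `p • b = 0`
    have hpb0 : p • b = 0 := by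
      obtain ⟨z, hz⟩ := (charModuleEquiv θ).symm.surjective (p • b)
      have h := hpb h₀
      rw [← hz, galois_smul_charModuleEquiv_symm] at h
      have h' := (charModuleEquiv θ).symm.injective h
      have hz0 : z = 0 := by
        have e : (((unitChar θ (h₀ : absoluteGaloisGroup K) : ℤ_[p]ˣ) : ℤ_[p]) - 1) • z = 0 := by
          rw [sub_smul, one_smul, h', sub_self]
        exact (hunit.smul_eq_zero).mp e
      rw [← hz, hz0, map_zero]
    -- so `b = j a`
    obtain ⟨a, rfl⟩ : b ∈ j.range := (hrange b).mpr hpb0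
    refine ⟨a, fun g ↦ ?_⟩
    rw [map_sub]
    change (g : absoluteGaloisGroup K) • j a - j a = j ((g : absoluteGaloisGroup K) • a) - j a
    rw [hj]

/-- **Kummer injectivity for a character: `j_* : H¹(H, A) → H¹(H, (F/𝒪)(θ))` is injective** for
`θ^{p−1} = 1`, any `H ≤ Γ_K`, and `j : A ↪ (F/𝒪)(θ)` equivariant onto the `p`-torsion (`A ≅ 𝔽(θ̄)`).
[cite: KellerYin2024, Lemma 1.2.4 (arXiv:2402.12781v2)] [cite: CastellaGrossiLeeSkinner2022, Lemma 13] -/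
theorem resH1Hom_id_injective_charModule (hθ : ∀ σ : absoluteGaloisGroup K, θ σ ^ (p - 1) = 1)
    (H : Subgroup (absoluteGaloisGroup K))
    (j : A →+ charModule (∅ : Set (PadicAlgCl p)) θ)
    (hj : ∀ (σ : absoluteGaloisGroup K) (a : A), j (σ • a) = σ • j a) (hinj : Function.Injective j)
    (hrange : ∀ x : charModule (∅ : Set (PadicAlgCl p)) θ, x ∈ j.range ↔ p • x = 0) :
    Function.Injective (resH1Hom (ContinuousMonoidHom.id H) j (fun g a ↦ hj (g : absoluteGaloisGroup K) a)) :=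
  resH1Hom_id_injective_of_coboundary_lift (G := H) j _ hinj
    (coboundary_lift_charModule θ hθ H j hj hrange)

end Character

/-! ### §4 Assembly: the residual strict Selmer group of `A ≅ 𝔽(θ̄)` is finite -/

section Assembly

variable {K : Type} [Field K] [NumberField K] {p : ℕ} [hp : Fact p.Prime]
  (θ : FramedGaloisRep K (padicCoeffIntegers (∅ : Set (PadicAlgCl p))) 1)
  (κ : ZpExtension K p) (vbar : HeightOneSpectrum (𝓞 K)) (S₀ : Set (HeightOneSpectrum (𝓞 K)))

variable {A : Type} [AddCommGroup A] [DistribMulAction (absoluteGaloisGroup K) A] [TopologicalSpace A]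
  [DiscreteTopology A]

/-- **`R_v̄^{S₀}(K_∞, A)` is finite when `H¹_{𝓕_nr^{S₀}}(K_∞, (F/𝒪)(θ))[p]` is**, for `A ↪ (F/𝒪)(θ)`
equivariant onto the `p`-torsion (`θ^{p−1} = 1`): `j_*` is injective on `H¹(K_∞, A)` (§3), sends
Castella's residual strict group `R(A)` into the strict group of `(F/𝒪)(θ)`
(`resH1Hom_id_mem_residualSelmer`) which lies in the unramified one (`grSelmer_le_unrSelmer`), and every
class of `H¹(K_∞, A)` is `p`-torsion (`pA = 0`).
[cite: KellerYin2024, Lemma 1.2.4 and Prop. 1.2.5 (arXiv:2402.12781v2 TeX L760–800)]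
[cite: CastellaGrossiLeeSkinner2022, Lemma 13, Prop. 14 (arXiv:2008.02571 §1.2)] -/
theorem finite_residualStrictSelmer_of_finite_pTorsion
    (hθ : ∀ σ : absoluteGaloisGroup K, θ σ ^ (p - 1) = 1)
    (j : A →+ charModule (∅ : Set (PadicAlgCl p)) θ)
    (hj : ∀ (σ : absoluteGaloisGroup K) (a : A), j (σ • a) = σ • j a) (hinj : Function.Injective j)
    (hrange : ∀ x : charModule (∅ : Set (PadicAlgCl p)) θ, x ∈ j.range ↔ p • x = 0)
    (hfin : Set.Finite {s : unrSelmer κ (charModule (∅ : Set (PadicAlgCl p)) θ) vbar S₀ | p • s = 0}) :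
    (datumStrictSelmer κ.kerSubgroup A p (AcSelmer.bdpData A p vbar) S₀ :
      Set (Literature.NumberTheory.EllipticCurves.subgroupH1 κ.kerSubgroup A)).Finite := by
  -- notation
  let H := κ.kerSubgroup
  have hjH : ∀ (g : H) (a : A), j (ContinuousMonoidHom.id H g • a) = g • j a :=
    fun g a ↦ hj (g : absoluteGaloisGroup K) a
  let jH := resH1Hom (ContinuousMonoidHom.id H) j hjH
  have hinjH : Function.Injective jH := resH1Hom_id_injective_charModule θ hθ H j hj hinj hrange
  -- `pA = 0`, so every class of `H¹(H, A)` is `p`-torsion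
  have hpA : ∀ a : A, p • a = 0 := fun a ↦ hinj (by
    rw [map_nsmul, map_zero]; exact (hrange (j a)).mp ⟨a, rfl⟩)
  have hpc : ∀ c : Literature.NumberTheory.EllipticCurves.subgroupH1 H A, p • c = 0 :=
    nsmul_discreteH1_eq_zero (G := H) hpA
  -- `j_*` sends `R(A)` into `R((F/𝒪)(θ)) ⊆ H¹_{𝓕_nr^{S₀}}`
  have hmem : ∀ c : Literature.NumberTheory.EllipticCurves.subgroupH1 H A,
      c ∈ datumStrictSelmer H A p (AcSelmer.bdpData A p vbar) S₀ →
        jH c ∈ unrSelmer κ (charModule (∅ : Set (PadicAlgCl p)) θ) vbar S₀ := by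
    intro c hc
    have h1 : jH c ∈ datumStrictSelmer H (charModule (∅ : Set (PadicAlgCl p)) θ) p
        (AcSelmer.bdpData (charModule (∅ : Set (PadicAlgCl p)) θ) p vbar) S₀ :=
      resH1Hom_id_mem_residualSelmer H p vbar S₀ j hj hjH hc
    have h2 : jH c ∈ grSelmer κ (charModule (∅ : Set (PadicAlgCl p)) θ) vbar S₀ := h1
    exact grSelmer_le_unrSelmer κ _ vbar S₀ h2
  -- the injection into the finite set
  haveI : Finite {s : unrSelmer κ (charModule (∅ : Set (PadicAlgCl p)) θ) vbar S₀ | p • s = 0} :=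
    hfin.to_subtype
  let f : (datumStrictSelmer H A p (AcSelmer.bdpData A p vbar) S₀ :
      Set (Literature.NumberTheory.EllipticCurves.subgroupH1 H A)) →
        {s : unrSelmer κ (charModule (∅ : Set (PadicAlgCl p)) θ) vbar S₀ | p • s = 0} :=
    fun c ↦ ⟨⟨jH c.1, hmem c.1 c.2⟩, by
      change p • (⟨jH c.1, hmem c.1 c.2⟩ : unrSelmer κ (charModule (∅ : Set (PadicAlgCl p)) θ) vbar S₀) = 0
      apply Subtype.ext
      change p • jH c.1 = 0
      rw [← map_nsmul, hpc, map_zero]⟩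
  have hf : Function.Injective f := by
    intro c c' h
    have h' : jH c.1 = jH c'.1 := congrArg (fun s ↦ ((s.1 : unrSelmer κ _ vbar S₀) :
      Literature.NumberTheory.EllipticCurves.subgroupH1 H (charModule (∅ : Set (PadicAlgCl p)) θ))) h
    exact Subtype.ext (hinjH h')
  exact Set.finite_coe_iff.mp (Finite.of_injective f hf)

/-- **`R_v̄^{S₀}(K_∞, A)` is finite when some dual datum of `H¹_{𝓕_nr^{S₀}}(K_∞, (F/𝒪)(θ))` is finitely
generated `Λ`-torsion with `μ = 0`** (`A ↪ (F/𝒪)(θ)` equivariant onto the `p`-torsion, `θ^{p−1} = 1`): §1 +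
the previous theorem. This is the character-level input of the residual dévissage for Keller–Yin
Thm. 1.4.1's cotorsion clauses, obtained from Prop. 1.2.5's first clause instead of the preprint
finiteness clause. [cite: KellerYin2024, Prop. 1.2.5 (arXiv:2402.12781v2 TeX L780–800), Thm. 1.4.1 (L1087–1098)]
[cite: Washington1997, §13.2] [cite: LimSujatha2018, §3] -/
theorem finite_residualStrictSelmer_of_dualData
    (hθ : ∀ σ : absoluteGaloisGroup K, θ σ ^ (p - 1) = 1)
    (j : A →+ charModule (∅ : Set (PadicAlgCl p)) θ)
    (hj : ∀ (σ : absoluteGaloisGroup K) (a : A), j (σ • a) = σ • j a) (hinj : Function.Injective j)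
    (hrange : ∀ x : charModule (∅ : Set (PadicAlgCl p)) θ, x ∈ j.range ↔ p • x = 0)
    {γ : absoluteGaloisGroup K}
    (D : DatumDualData κ γ (charModule (∅ : Set (PadicAlgCl p)) θ)
      (Literature.NumberTheory.EllipticCurves.Castella2018.AcSelmer.bdpData
        (charModule (∅ : Set (PadicAlgCl p)) θ) p vbar) S₀)
    (hfg : Module.Finite (IwasawaAlgebra p) D.X) (hT : Module.IsTorsion (IwasawaAlgebra p) D.X)
    (hμ : muInvariant p D.X = 0) :
    (datumStrictSelmer κ.kerSubgroup A p (AcSelmer.bdpData A p vbar) S₀ :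
      Set (Literature.NumberTheory.EllipticCurves.subgroupH1 κ.kerSubgroup A)).Finite :=
  haveI := hfg
  finite_residualStrictSelmer_of_finite_pTorsion θ κ vbar S₀ hθ j hj hinj hrange
    (finite_pTorsion_of_muInvariant_eq_zero D hT hμ)

/-- **The same from the `∀`-form the line carries** ("every dual datum of `H¹_{𝓕_nr^{S₀}}(K_∞, (F/𝒪)(θ))`
is finitely generated `Λ`-torsion with `μ = 0`", the first clause of
`KellerYin2024.prop125_residualPair_unrSelmer_imprimitive`), for `γ` a topological generator of `κ`
(dual data exist: `nonempty_unrDualData_char`).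
[cite: KellerYin2024, Prop. 1.2.5 (arXiv:2402.12781v2 TeX L780–800)] [cite: GreenbergLNM1716, §1 (after Conj. 1.3)] -/
theorem finite_residualStrictSelmer_of_forall_dualData
    (hθ : ∀ σ : absoluteGaloisGroup K, θ σ ^ (p - 1) = 1)
    (j : A →+ charModule (∅ : Set (PadicAlgCl p)) θ)
    (hj : ∀ (σ : absoluteGaloisGroup K) (a : A), j (σ • a) = σ • j a) (hinj : Function.Injective j)
    (hrange : ∀ x : charModule (∅ : Set (PadicAlgCl p)) θ, x ∈ j.range ↔ p • x = 0)
    {γ : absoluteGaloisGroup K} (hγ : κ.IsTopGenerator γ)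
    (hS : ∀ D : DatumDualData κ γ (charModule (∅ : Set (PadicAlgCl p)) θ)
      (Literature.NumberTheory.EllipticCurves.Castella2018.AcSelmer.bdpData
        (charModule (∅ : Set (PadicAlgCl p)) θ) p vbar) S₀,
      Module.Finite (IwasawaAlgebra p) D.X ∧ Module.IsTorsion (IwasawaAlgebra p) D.X ∧
        muInvariant p D.X = 0) :
    (datumStrictSelmer κ.kerSubgroup A p (AcSelmer.bdpData A p vbar) S₀ :
      Set (Literature.NumberTheory.EllipticCurves.subgroupH1 κ.kerSubgroup A)).Finite := by
  obtain ⟨D⟩ := nonempty_unrDualData_char (∅ : Set (PadicAlgCl p)) θ κ vbar S₀ hγ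
  obtain ⟨hfg, hT, hμ⟩ := hS D
  exact finite_residualStrictSelmer_of_dualData θ κ vbar S₀ hθ j hj hinj hrange D hfg hT hμ

end Assembly

end Summit.BirchSwinnertonDyer.BirchSwinnertonDyer.Theorems.CharResidualSelmerFinite

end
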